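import Literature.NumberTheory.Automorphic.PlaneLatticesSelfDualGlued             -- ★ (L5-b): `u`-coordinate lemmas (σ-free), `zpow_uniformizer_mem_integer_iff`; transitively ★ (L5-a) Hermite currency
import Literature.NumberTheory.Automorphic.HermitianLatticeTreeTransitive          -- ★ `IsUnimodular₂`, `isUnimodular₂_iff_exists_mem_glInt`, `isUnimodular₂_inv_smul_iff_exists_mem_glInt`
import HarnessLib

/-!
# Self-dual and `ϖ`-modular plane lattices in Hermite coordinates at a TAMELY RAMIFIED place (`σ ϖ = −ϖ`, diagonal unit form `diag(h₀, h₁)`):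
# `Λ(T(k, y, d−k))`, `u := ϖ^{k−d} y ∈ 𝒪`, `h₀·u σu + h₁ ≡ 0 (ϖ^{2k−d})` — the shells `2q^k` (self-dual, `d = 0`) and `2q^{k−1}` (`ϖ`-modular, `d = 1`) of the barycentric tree
(Jacobowitz 1962, §7–§8; Labesse–Langlands 1979, §2 p. 8 «`δ_m = 2q^m`»; Serre, *Trees*, II.1.1; Macdonald, *Symmetric functions*, Ch. V §2)

Topic `NumberTheory/Automorphic`; namespace `Literature.NumberTheory.Automorphic`.  THEOREMS ONLY (no definition, no instance, no notation, no named fact, no `sorry`).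
Cell `pub/hodgecm-mathlib` (D-0151), crux H413 = `stmt-HodgeConjecture-24833`, road «R1-ram» (F0P3-p02 (g12) MEMO-R1ram §4; architect A-p16 (g27) RULINGS A-15 (b) ∕ A-17 (a)),
brick **R-2 «RAMIFIED TREE COUNTS»**, FILE R2-B (A-p01 (g21); census `F0/P3a/A-p01/g21/CENSUS-R2-RamifiedTreeCounts.A-p01g21.md` §0 (a)(b)).  The RAMIFIED TWIN of
★ (L5-b) `PlaneLatticesSelfDualGlued` (whose hypotheses `σ ϖ = ϖ` and scalar form `ϖ^e · 1` both fail here): at a ramified place the Gram parity `e` disappears (every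
diagonal unit Gram matrix is reached by column rescaling), the two vertex TYPES are told apart by the modularity exponent `d ∈ {0, 1}` (`d = 0`: self-dual = EDGE
MIDPOINTS of the tree of `U(1,1)`, `d = 1`: `ϖ`-modular = VERTICES), and the gluing weight is the RAMIFIED norm fibre `2q^{⌊j∕2⌋}` of ★ R2-A (inert: `q^{j−1}(q+1)`).
HONEST LABEL: HC_CM is proved only modulo the printed citations (hLiu418, h413) until rung 0 closes; nothing printed is a letter here — lattice algebra over a valuation ring.

SETTING.  `F` a field with `[ValuativeRel F]` (model `L_w`), `ϖ` a uniformizing element with `σ ϖ = −ϖ` (`σ : F →+* F` the conjugation, `σ 𝒪 ⊆ 𝒪`), `h : Fin 2 → F` with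
`|h i| = 1` (the DIAGONAL UNIT Gram matrix `Matrix.diagonal h` of a column-rescaled orthogonal eigenframe of the elliptic torus `E¹ × E¹`; A-17 (a) (α)), Hermite matrices
`↑g = T(k, y, l) = !![ϖ^k, y; 0, ϖ^l]` (★ (L5-a)), lattices `Λ(g) = span 𝒪 (range (↑g)ᵀ)`, `u := ϖ^{k−d} y`, `j := 2k − d`, `r := −h₁ ∕ h₀`.
* §1 `map_zpow_of_map_eq_neg` (`σ(ϖ^m) = (−1)^m ϖ^m`), **`formCongr_hermite_diagonal`** (the Gram matrix `(σT)ᵀ·diag h·T`).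
* §2 **`isUnimodular₂_zpow_smul_formCongr_hermite_diagonal_iff`**: `ϖ^{−d}·Gram ∈ GL₂(𝒪)` ⟺ `l = d − k ∧ 0 ≤ 2k − d ∧ u ∈ 𝒪 ∧ ϖ^{−(2k−d)}(h₀ u σu + h₁) ∈ 𝒪`; the socket
  tokens **`exists_mem_glInt_coe_eq_formCongr_hermite_diagonal_iff`** (`d = 0`, `∃ J′ ∈ glInt 2 F, ↑J′ = …`) and **`exists_mem_glInt_smul_coe_eq_formCongr_hermite_diagonal_iff`**
  (`d = 1`, `ϖ • ↑J′ = …`); `valuation_eq_one_of_norm_congr_diagonal` (`j ≥ 1 ⇒ |u| = 1`).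
* §3 STABILITY **`map_diag_span_eq_self_iff_of_modular_hermite_diagonal`**: for `|a| = |c| = 1`, `diag(a,c)Λ = Λ ⟺ ϖ^{−(2k−d)}(a − c) ∈ 𝒪` («`X′`-distance `≤ N`»).
* §4 COUNT **`ncard_modular_hermite_diagonal_eq_natCard`**: the lattices `Λ(T(k, y, d−k))` with `ϖ^{−d}`-unimodular Gram number `Nat.card {ū ∈ 𝒪 ⧸ 𝔪^j : ū σ̄ū = r̄}` — the subtype
  that R2-A `RamifiedQuadraticNorm.natCard_norm_fibre_quotient_pow_ramified` evaluates to `2 q^{⌊j∕2⌋}` (`j ≥ 1`; `1` for `j = 0`); the evaluated depth counts are R2-C.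

## References
* [Jacobowitz1962] R. Jacobowitz, *Hermitian forms over local fields*, Amer. J. Math. 84 (1962), §7–§8 (unimodular and `𝔭`-modular lattices, ramified case).
* [LabesseLanglands1979] J.-P. Labesse, R. P. Langlands, *L-indistinguishability for SL(2)*, Canad. J. Math. 31 (1979), §2 p. 8.
* [Serre1980Trees] J.-P. Serre, *Trees* (1980), Ch. II §1.1.
* [Macdonald1995] I. G. Macdonald, *Symmetric functions and Hall polynomials*, 2nd ed. (1995), Ch. V §2.
-/

set_option autoImplicit false

noncomputable section

open scoped ValuativeRel Matrix MatrixGroups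
open Matrix ValuativeRel IsLocalRing Literature.NumberTheory.LocalFields Literature.NumberTheory.Automorphic.HermitianLatticeTree

namespace Literature.NumberTheory.Automorphic

variable {F : Type*} [Field F] [ValuativeRel F] {ϖ : F} (hϖ : IsUniformizingElement ϖ) (σ : F →+* F)

/-! ## §1 Signs and the Gram matrix of a Hermite matrix against a diagonal form -/

section Gram

omit [ValuativeRel F] in
/-- `σ(ϖ^m) = (−1)^m ϖ^m` for an anti-fixed uniformiser `σ ϖ = −ϖ`. [cite: Jacobowitz1962, §8] -/
theorem map_zpow_of_map_eq_neg (hσϖ : σ ϖ = -ϖ) (m : ℤ) : σ (ϖ ^ m) = (-1) ^ m * ϖ ^ m := by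
  rw [map_zpow₀, hσϖ, neg_eq_neg_one_mul, mul_zpow]

omit [ValuativeRel F] in
/-- `(−1)^m · (−1)^m = 1`. [cite: Jacobowitz1962, §8] -/
theorem neg_one_zpow_mul_self (m : ℤ) : ((-1 : F) ^ m) * (-1) ^ m = 1 := by
  rw [← zpow_add₀ (neg_ne_zero.2 (one_ne_zero' F))]
  exact Even.neg_one_zpow ⟨m, rfl⟩

omit [ValuativeRel F] in
/-- `(−1)^{−m} = (−1)^m`. [cite: Jacobowitz1962, §8] -/
theorem neg_one_zpow_neg (m : ℤ) : ((-1 : F) ^ (-m)) = (-1) ^ m := by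
  rw [_root_.zpow_neg]
  exact inv_eq_of_mul_eq_one_right (neg_one_zpow_mul_self m)

/-- `|(−1)^m| = 1`. [cite: Jacobowitz1962, §8] -/
theorem valuation_neg_one_zpow (m : ℤ) : valuation F ((-1 : F) ^ m) = 1 := by
  rw [map_zpow₀, Valuation.map_neg, map_one, _root_.one_zpow]

omit [ValuativeRel F] in
/-- **The Gram matrix of `T(k, y, l) = !![ϖ^k, y; 0, ϖ^l]` for the diagonal form `diag(h₀, h₁)`**:
`(σT)ᵀ·diag h·T = !![σ(ϖ^k) h₀ ϖ^k, σ(ϖ^k) h₀ y; σy h₀ ϖ^k, σy h₀ y + σ(ϖ^l) h₁ ϖ^l]`. [cite: Jacobowitz1962, §7] [cite: Macdonald1995, Ch. V §2] -/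
theorem formCongr_hermite_diagonal (h : Fin 2 → F) {k l : ℤ} {y : F} (g : GL (Fin 2) F) (hg : (g : Matrix (Fin 2) (Fin 2) F) = !![ϖ ^ k, y; 0, ϖ ^ l]) :
    formCongr σ g (Matrix.diagonal h) =
      !![σ (ϖ ^ k) * h 0 * ϖ ^ k, σ (ϖ ^ k) * h 0 * y; σ y * h 0 * ϖ ^ k, σ y * h 0 * y + σ (ϖ ^ l) * h 1 * ϖ ^ l] := by
  have hmap : ((!![ϖ ^ k, y; 0, ϖ ^ l] : Matrix (Fin 2) (Fin 2) F).map σ)ᵀ = !![σ (ϖ ^ k), 0; σ y, σ (ϖ ^ l)] := by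
    ext i j; fin_cases i <;> fin_cases j <;> simp
  have hH : Matrix.diagonal h = !![h 0, 0; 0, h 1] := by
    ext i j; fin_cases i <;> fin_cases j <;> simp
  rw [formCongr, hg, hmap, hH]
  ext i j; fin_cases i <;> fin_cases j <;> simp [Matrix.mul_apply, Fin.sum_univ_two]

end Gram

/-! ## §2 `ϖ^d`-modularity of a Hermite lattice for a diagonal unit form: «integral ⟺ unimodular», and the norm congruence -/

section Modular

variable {h : Fin 2 → F} (hh0 : valuation F (h 0) = 1) (hh1 : valuation F (h 1) = 1)

/-- A unit factor on the LEFT does not change integrality: for `|u| = 1`, `u z ∈ 𝒪 ⟺ z ∈ 𝒪`. [cite: Macdonald1995, Ch. V §2] -/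
theorem unit_mul_mem_integer_iff {u : F} (hu : valuation F u = 1) (z : F) : u * z ∈ 𝒪[F] ↔ z ∈ 𝒪[F] := by
  rw [mul_comm]; exact mul_mem_integer_iff_of_valuation_eq_one hu z

include hϖ hh0 hh1 in
/-- **`ϖ^d`-MODULARITY IN HERMITE COORDINATES (ramified).**  For `σ ϖ = −ϖ`, `σ 𝒪 ⊆ 𝒪`, a diagonal UNIT form `diag h` (`|h i| = 1`), `↑g = T(k, y, l)` and `d ∈ ℤ`:
`ϖ^{−d} · (σT)ᵀ (diag h) T` is unimodular iff `l = d − k`, `0 ≤ 2k − d`, `u := ϖ^{k−d} y ∈ 𝒪` and `ϖ^{−(2k−d)} (h₀ · u σu + h₁) ∈ 𝒪` — then the matrix is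
`!![±h₀ϖ^{2k−d}, ±h₀u; ±h₀σu, ±ϖ^{−(2k−d)}(h₀ uσu + h₁)]` with determinant `±h₀h₁`, so «integral ⟺ unimodular»; NO parity condition (contrast ★ inert `j ≡ e (2)`):
`d = 0` = self-dual (edge midpoints, `j = 2k`), `d = 1` = `ϖ`-modular (vertices, `j = 2k − 1`). [cite: Jacobowitz1962, §7–§8] [cite: LabesseLanglands1979, §2 p. 8] -/
theorem isUnimodular₂_zpow_smul_formCongr_hermite_diagonal_iff (hσϖ : σ ϖ = -ϖ) (hσO : ∀ x ∈ 𝒪[F], σ x ∈ 𝒪[F]) (d : ℤ) {k l : ℤ} {y : F}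
    (g : GL (Fin 2) F) (hg : (g : Matrix (Fin 2) (Fin 2) F) = !![ϖ ^ k, y; 0, ϖ ^ l]) :
    IsUnimodular₂ (ϖ ^ (-d) • formCongr σ g (Matrix.diagonal h)) ↔
      l = d - k ∧ 0 ≤ 2 * k - d ∧ ϖ ^ (k - d) * y ∈ 𝒪[F] ∧
        ϖ ^ (-(2 * k - d)) * (h 0 * (ϖ ^ (k - d) * y * σ (ϖ ^ (k - d) * y)) + h 1) ∈ 𝒪[F] := by
  have h0 := hϖ.ne_zero
  have h10 : (-1 : F) ≠ 0 := neg_ne_zero.2 one_ne_zero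
  have hz : ∀ a b : ℤ, ϖ ^ a * ϖ ^ b = ϖ ^ (a + b) := fun a b => (zpow_add₀ h0 a b).symm
  have hε := map_zpow_of_map_eq_neg σ hσϖ
  have hεε := neg_one_zpow_mul_self (F := F)
  have hεv := valuation_neg_one_zpow (F := F)
  have hG := formCongr_hermite_diagonal σ h g hg
  -- the matrix `X = ϖ^{-d} · Gram` entrywise
  have hX : ϖ ^ (-d) • formCongr σ g (Matrix.diagonal h) =
      !![ϖ ^ (-d) * (σ (ϖ ^ k) * h 0 * ϖ ^ k), ϖ ^ (-d) * (σ (ϖ ^ k) * h 0 * y);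
         ϖ ^ (-d) * (σ y * h 0 * ϖ ^ k), ϖ ^ (-d) * (σ y * h 0 * y + σ (ϖ ^ l) * h 1 * ϖ ^ l)] := by
    rw [hG]; ext i j; fin_cases i <;> fin_cases j <;> rfl
  -- atoms: `u = ϖ^{k-d} y`, `ϖ^{k-d} = ϖ^k ϖ^{-d}`, signs
  have hkd : ϖ ^ (k - d) = ϖ ^ k * ϖ ^ (-d) := by rw [sub_eq_add_neg, ← hz]
  have hσu : σ (ϖ ^ (k - d) * y) = (-1) ^ (k - d) * (ϖ ^ (k - d) * σ y) := by rw [map_mul, hε]; ring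
  have hσu' : ϖ ^ (k - d) * σ y = (-1) ^ (k - d) * σ (ϖ ^ (k - d) * y) := by
    rw [hσu, ← mul_assoc, hεε, one_mul]
  -- entry formulas
  have e00 : ϖ ^ (-d) * (σ (ϖ ^ k) * h 0 * ϖ ^ k) = ((-1) ^ k * h 0) * ϖ ^ (2 * k - d) := by
    rw [hε, show 2 * k - d = k + k + -d by ring, ← hz, ← hz]; ring
  have e01 : ϖ ^ (-d) * (σ (ϖ ^ k) * h 0 * y) = ((-1) ^ k * h 0) * (ϖ ^ (k - d) * y) := by rw [hε, hkd]; ring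
  have e10 : ϖ ^ (-d) * (σ y * h 0 * ϖ ^ k) = ((-1) ^ (k - d) * h 0) * σ (ϖ ^ (k - d) * y) := by
    rw [mul_assoc ((-1) ^ (k - d)), mul_left_comm ((-1) ^ (k - d)), ← hσu', hkd]; ring
  have e11 : l = d - k → ϖ ^ (-d) * (σ y * h 0 * y + σ (ϖ ^ l) * h 1 * ϖ ^ l) =
      (-1) ^ (k - d) * (ϖ ^ (-(2 * k - d)) * (h 0 * (ϖ ^ (k - d) * y * σ (ϖ ^ (k - d) * y)) + h 1)) := by
    rintro rfl
    have hEneg : ((-1 : F)) ^ (d - k) = (-1) ^ (k - d) := by rw [← neg_one_zpow_neg (k - d), neg_sub]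
    have hP : ϖ ^ (-(2 * k - d)) = ϖ ^ (-d) * ϖ ^ (d - k) * ϖ ^ (d - k) := by rw [hz, hz]; congr 1; ring
    have e1 : ϖ ^ (k - d) * ϖ ^ (d - k) = 1 := by rw [hz, add_comm, sub_add_sub_cancel, sub_self, zpow_zero]
    rw [hσu, hε (d - k), hEneg, hP]
    linear_combination (-(ϖ ^ (-d) * h 0 * y * σ y * (ϖ ^ (k - d) * ϖ ^ (d - k)) ^ 2)) * hεε (k - d)
      + (-(ϖ ^ (-d) * h 0 * y * σ y * (ϖ ^ (k - d) * ϖ ^ (d - k) + 1))) * e1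
  -- the determinant
  have hdet : (ϖ ^ (-d) • formCongr σ g (Matrix.diagonal h)).det = ((-1) ^ k * (-1) ^ l * (h 0 * h 1)) * ϖ ^ (2 * (k + l - d)) := by
    rw [Matrix.det_smul, hG, Matrix.det_fin_two_of, Fintype.card_fin, hε, hε, show 2 * (k + l - d) = -d + -d + (k + k + (l + l)) by ring,
      ← hz, ← hz, ← hz, ← hz, ← hz]
    ring
  have hdetv : valuation F (ϖ ^ (-d) • formCongr σ g (Matrix.diagonal h)).det = 1 ↔ l = d - k := by
    rw [hdet]
    simp only [map_mul, hεv, hh0, hh1, one_mul]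
    rw [valuation_zpow_uniformizer_eq_one_iff hϖ]
    omega
  have hv0 : ∀ m : ℤ, valuation F ((-1) ^ m * h 0) = 1 := fun m => by rw [map_mul, hεv, hh0, one_mul]
  constructor
  · rintro ⟨hint, hdet1⟩
    have hl : l = d - k := hdetv.1 hdet1
    have i00 : ϖ ^ (-d) * (σ (ϖ ^ k) * h 0 * ϖ ^ k) ∈ 𝒪[F] := by have h' := hint 0 0; rw [hX] at h'; exact h'
    have i01 : ϖ ^ (-d) * (σ (ϖ ^ k) * h 0 * y) ∈ 𝒪[F] := by have h' := hint 0 1; rw [hX] at h'; exact h'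
    have i11 : ϖ ^ (-d) * (σ y * h 0 * y + σ (ϖ ^ l) * h 1 * ϖ ^ l) ∈ 𝒪[F] := by have h' := hint 1 1; rw [hX] at h'; exact h'
    rw [e00, unit_mul_mem_integer_iff (hv0 k), zpow_uniformizer_mem_integer_iff hϖ] at i00
    rw [e01, unit_mul_mem_integer_iff (hv0 k)] at i01
    rw [e11 hl, unit_mul_mem_integer_iff (hεv _)] at i11
    exact ⟨hl, i00, i01, i11⟩
  · rintro ⟨hl, hkd0, hu, hN⟩
    refine ⟨fun i j => ?_, hdetv.2 hl⟩
    rw [hX]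
    fin_cases i <;> fin_cases j
    · show ϖ ^ (-d) * (σ (ϖ ^ k) * h 0 * ϖ ^ k) ∈ 𝒪[F]
      rw [e00, unit_mul_mem_integer_iff (hv0 k), zpow_uniformizer_mem_integer_iff hϖ]; exact hkd0
    · show ϖ ^ (-d) * (σ (ϖ ^ k) * h 0 * y) ∈ 𝒪[F]
      rw [e01, unit_mul_mem_integer_iff (hv0 k)]; exact hu
    · show ϖ ^ (-d) * (σ y * h 0 * ϖ ^ k) ∈ 𝒪[F]
      rw [e10, unit_mul_mem_integer_iff (hv0 (k - d))]; exact hσO _ hu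
    · show ϖ ^ (-d) * (σ y * h 0 * y + σ (ϖ ^ l) * h 1 * ϖ ^ l) ∈ 𝒪[F]
      rw [e11 hl, unit_mul_mem_integer_iff (hεv (k - d))]; exact hN

include hϖ hh0 hh1 in
/-- **The SELF-DUAL token** (`d = 0`, the socket's `∃ J′ ∈ glInt 2 F, ↑J′ = formCongr σ g (diag h)`): `↑g = T(k, y, l)` is self-dual iff `l = −k`, `0 ≤ k`, `u := ϖ^k y ∈ 𝒪`,
`ϖ^{−2k}(h₀ uσu + h₁) ∈ 𝒪` — EDGE MIDPOINTS of depth `k` (`X′`-distance `2k`). [cite: Jacobowitz1962, §7] [cite: LabesseLanglands1979, §2 p. 8] -/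
theorem exists_mem_glInt_coe_eq_formCongr_hermite_diagonal_iff (hσϖ : σ ϖ = -ϖ) (hσO : ∀ x ∈ 𝒪[F], σ x ∈ 𝒪[F]) {k l : ℤ} {y : F}
    (g : GL (Fin 2) F) (hg : (g : Matrix (Fin 2) (Fin 2) F) = !![ϖ ^ k, y; 0, ϖ ^ l]) :
    (∃ J' ∈ glInt 2 F, (J' : Matrix (Fin 2) (Fin 2) F) = formCongr σ g (Matrix.diagonal h)) ↔
      l = -k ∧ 0 ≤ k ∧ ϖ ^ k * y ∈ 𝒪[F] ∧ ϖ ^ (-(2 * k)) * (h 0 * (ϖ ^ k * y * σ (ϖ ^ k * y)) + h 1) ∈ 𝒪[F] := by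
  have key := isUnimodular₂_zpow_smul_formCongr_hermite_diagonal_iff hϖ σ hh0 hh1 hσϖ hσO 0 g hg
  rw [neg_zero, zpow_zero, one_smul, isUnimodular₂_iff_exists_mem_glInt] at key
  rw [key, zero_sub, sub_zero, sub_zero]
  exact ⟨fun ⟨h1, h2, h3, h4⟩ => ⟨h1, by omega, h3, h4⟩, fun ⟨h1, h2, h3, h4⟩ => ⟨h1, by omega, h3, h4⟩⟩

include hϖ hh0 hh1 in
/-- **The `ϖ`-MODULAR token** (`d = 1`, the socket's `∃ J′ ∈ glInt 2 F, ϖ • ↑J′ = formCongr σ g (diag h)`): `↑g = T(k, y, l)` is `ϖ`-modular iff `l = 1 − k`, `1 ≤ k`,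
`u := ϖ^{k−1} y ∈ 𝒪`, `ϖ^{−(2k−1)}(h₀ uσu + h₁) ∈ 𝒪` — VERTICES of depth `k` (`X′`-distance `2k − 1`). [cite: Jacobowitz1962, §8] [cite: LabesseLanglands1979, §2 p. 8] -/
theorem exists_mem_glInt_smul_coe_eq_formCongr_hermite_diagonal_iff (hσϖ : σ ϖ = -ϖ) (hσO : ∀ x ∈ 𝒪[F], σ x ∈ 𝒪[F]) {k l : ℤ} {y : F}
    (g : GL (Fin 2) F) (hg : (g : Matrix (Fin 2) (Fin 2) F) = !![ϖ ^ k, y; 0, ϖ ^ l]) :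
    (∃ J' ∈ glInt 2 F, ϖ • (J' : Matrix (Fin 2) (Fin 2) F) = formCongr σ g (Matrix.diagonal h)) ↔
      l = 1 - k ∧ 1 ≤ k ∧ ϖ ^ (k - 1) * y ∈ 𝒪[F] ∧ ϖ ^ (-(2 * k - 1)) * (h 0 * (ϖ ^ (k - 1) * y * σ (ϖ ^ (k - 1) * y)) + h 1) ∈ 𝒪[F] := by
  have key := isUnimodular₂_zpow_smul_formCongr_hermite_diagonal_iff hϖ σ hh0 hh1 hσϖ hσO 1 g hg
  rw [_root_.zpow_neg_one, isUnimodular₂_inv_smul_iff_exists_mem_glInt hϖ.ne_zero] at key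
  rw [key]
  exact ⟨fun ⟨h1, h2, h3, h4⟩ => ⟨h1, by omega, h3, h4⟩, fun ⟨h1, h2, h3, h4⟩ => ⟨h1, by omega, h3, h4⟩⟩

include hϖ hh0 hh1 in
/-- **`j ≥ 1` forces `u` to be a unit**: `u ∈ 𝒪`, `|h i| = 1`, `ϖ^{−j}(h₀ uσu + h₁) ∈ 𝒪`, `j ≥ 1` ⇒ `|u| = 1` (else `|h₀ uσu| < 1 = |h₁|`, so `|h₀uσu + h₁| = 1` and
`ϖ^{−j} ∈ 𝒪`). [cite: Jacobowitz1962, §7] [cite: Macdonald1995, Ch. V §2] -/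
theorem valuation_eq_one_of_norm_congr_diagonal (hσO : ∀ x ∈ 𝒪[F], σ x ∈ 𝒪[F]) {j : ℤ} (hj : 1 ≤ j) {u : F} (hu : u ∈ 𝒪[F])
    (hN : ϖ ^ (-j) * (h 0 * (u * σ u) + h 1) ∈ 𝒪[F]) : valuation F u = 1 := by
  have hu1 : valuation F u ≤ 1 := (Valuation.mem_integer_iff _ _).1 hu
  by_contra hne
  have hlt : valuation F (h 0 * (u * σ u)) < valuation F (h 1) := by
    rw [hh1, map_mul, hh0, one_mul, map_mul]
    calc valuation F u * valuation F (σ u) ≤ valuation F u * 1 := mul_le_mul' le_rfl ((Valuation.mem_integer_iff _ _).1 (hσO u hu))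
      _ < 1 := by rw [mul_one]; exact lt_of_le_of_ne hu1 hne
  have h1 : valuation F (h 0 * (u * σ u) + h 1) = 1 := by rw [Valuation.map_add_eq_of_lt_right _ hlt, hh1]
  have hne0 : h 0 * (u * σ u) + h 1 ≠ 0 := fun h0' => by rw [h0', map_zero] at h1; exact zero_ne_one h1
  have hmem : ϖ ^ (-j) ∈ 𝒪[F] := by
    have h2 := Subring.mul_mem _ hN ((Valuation.mem_integer_iff _ _).2 (le_of_eq (by rw [map_inv₀, h1, inv_one]) :
      valuation F (h 0 * (u * σ u) + h 1)⁻¹ ≤ 1))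
    rwa [mul_assoc, mul_inv_cancel₀ hne0, mul_one] at h2
  have := (zpow_uniformizer_mem_integer_iff hϖ _).1 hmem
  omega

end Modular

/-! ## §3 Stability under the torus: the fixed ball `X′`-dist`(Λ, Λ_C) ≤ N` -/

section Stability

variable {h : Fin 2 → F} (hh0 : valuation F (h 0) = 1) (hh1 : valuation F (h 1) = 1)

include hϖ hh0 hh1 in
/-- **STABILITY OF A `ϖ^d`-MODULAR HERMITE LATTICE UNDER `diag(a, c)` ⟺ `ϖ^{−(2k−d)}(a − c) ∈ 𝒪`** (`|a| = |c| = 1`; `↑g = T(k, y, d−k)` with `ϖ^{−d}`-unimodular Gram for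
`diag h`): the lattice at `X′`-distance `2k − d` from the root is fixed by the torus element `t = diag(a,c)` iff `2k − d ≤ N := ord_ϖ(a − c)` — «`Fix(t)` is the ball of
`X′`-radius `N` about the midpoint `Λ_C = 𝒪²`» (MEMO-R1ram §2 `B(e₀, r)`, `N = 2r+1`). Over ★ `map_diag_span_eq_self_iff_of_hermite` (σ-free) + §2.
[cite: LabesseLanglands1979, §2 p. 8] [cite: Serre1980Trees, Ch. II §1.1] -/
theorem map_diag_span_eq_self_iff_of_modular_hermite_diagonal (hσϖ : σ ϖ = -ϖ) (hσO : ∀ x ∈ 𝒪[F], σ x ∈ 𝒪[F]) (d : ℤ) {k : ℤ} {y a c : F}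
    (γ g : GL (Fin 2) F) (hγ : (γ : Matrix (Fin 2) (Fin 2) F) = !![a, 0; 0, c]) (ha : valuation F a = 1) (hc : valuation F c = 1)
    (hg : (g : Matrix (Fin 2) (Fin 2) F) = !![ϖ ^ k, y; 0, ϖ ^ (d - k)]) (hmod : IsUnimodular₂ (ϖ ^ (-d) • formCongr σ g (Matrix.diagonal h))) :
    (Submodule.span 𝒪[F] (Set.range ((g : Matrix (Fin 2) (Fin 2) F))ᵀ)).map
        ((Matrix.toLin' (γ : Matrix (Fin 2) (Fin 2) F)).restrictScalars 𝒪[F]) =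
      Submodule.span 𝒪[F] (Set.range ((g : Matrix (Fin 2) (Fin 2) F))ᵀ) ↔ ϖ ^ (-(2 * k - d)) * (a - c) ∈ 𝒪[F] := by
  have h0 := hϖ.ne_zero
  obtain ⟨-, hkd, hu, hN⟩ := (isUnimodular₂_zpow_smul_formCongr_hermite_diagonal_iff hϖ σ hh0 hh1 hσϖ hσO d g hg).1 hmod
  rw [map_diag_span_eq_self_iff_of_hermite hϖ γ g hγ ha hc hg]
  have e : ϖ ^ (-k) * ((a - c) * y) = ϖ ^ (-(2 * k - d)) * (a - c) * (ϖ ^ (k - d) * y) := by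
    have e' : ϖ ^ (-k) = ϖ ^ (-(2 * k - d)) * ϖ ^ (k - d) := by rw [← zpow_add₀ h0]; congr 1; ring
    rw [e']; ring
  rw [e]
  have haO : a ∈ 𝒪[F] := (Valuation.mem_integer_iff _ _).2 ha.le
  have hcO : c ∈ 𝒪[F] := (Valuation.mem_integer_iff _ _).2 hc.le
  rcases (show 2 * k - d = 0 ∨ 1 ≤ 2 * k - d by omega) with hj | hj
  · rw [hj, neg_zero, zpow_zero, one_mul]
    exact ⟨fun _ => Subring.sub_mem _ haO hcO, fun _ => Subring.mul_mem _ (Subring.sub_mem _ haO hcO) hu⟩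
  · rw [mul_mem_integer_iff_of_valuation_eq_one (valuation_eq_one_of_norm_congr_diagonal hϖ σ hh0 hh1 hσO hj hu hN)]

end Stability

/-! ## §4 Counting the `ϖ^d`-modular Hermite classes of depth `k`: the norm fibre over `r̄ = −h₁∕h₀` in `𝒪 ⧸ 𝔪^{2k−d}` -/

section Count

variable {h : Fin 2 → F} (hh0 : valuation F (h 0) = 1) (hh1 : valuation F (h 1) = 1)

include hϖ hh0 in
/-- **The norm congruence in `𝒪 ⧸ 𝔪^j`**: for `u ∈ 𝒪`, `r ∈ 𝒪` with `h₀ r = −h₁`, and the restriction `σO` of `σ` to `𝒪`: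
`ϖ^{−j}(h₀ · u σu + h₁) ∈ 𝒪 ⟺ ū · σ̄ū = r̄` in `𝒪 ⧸ 𝔪^j` — the subtype counted by ★ R2-A `natCard_norm_fibre_quotient_pow_ramified`. [cite: LabesseLanglands1979, §2 p. 8]
[cite: Jacobowitz1962, §7–§8] -/
theorem zpow_neg_mul_norm_congr_mem_iff (σO : 𝒪[F] →+* 𝒪[F]) (hσO : ∀ x : 𝒪[F], ((σO x : 𝒪[F]) : F) = σ x) (hσσ : ∀ a, σO (σO a) = a)
    (r : 𝒪[F]) (hr : h 0 * (r : F) = -h 1) (j : ℕ) (u : 𝒪[F]) :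
    ϖ ^ (-(j : ℤ)) * (h 0 * ((u : F) * σ u) + h 1) ∈ 𝒪[F] ↔
      Ideal.Quotient.mk (maximalIdeal 𝒪[F] ^ j) u *
          Ideal.quotientMap (maximalIdeal 𝒪[F] ^ j) σO (UnramifiedQuadraticNorm.maximalIdeal_pow_le_comap σO hσσ j) (Ideal.Quotient.mk (maximalIdeal 𝒪[F] ^ j) u) =
        Ideal.Quotient.mk (maximalIdeal 𝒪[F] ^ j) r := by
  have e : h 0 * ((u : F) * σ u) + h 1 = h 0 * (((u * σO u - r : 𝒪[F]) : 𝒪[F]) : F) := by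
    have e' : (((u * σO u - r : 𝒪[F]) : 𝒪[F]) : F) = (u : F) * σ u - r := by push_cast; rw [hσO]
    rw [e']; linear_combination hr
  rw [e, mul_left_comm, unit_mul_mem_integer_iff hh0, zpow_neg_mul_coe_mem_iff_dvd hϖ j, Ideal.quotientMap_mk, ← map_mul, Ideal.Quotient.eq, hϖ.span_eq,
    Ideal.span_singleton_pow, Ideal.mem_span_singleton]

include hϖ hh0 hh1 in
/-- **THE `ϖ^d`-MODULAR HERMITE CLASSES OF DEPTH `k` ARE COUNTED BY THE NORM FIBRE OVER `r̄ = −h₁∕h₀` IN `𝒪 ⧸ 𝔪^j`**, `j = 2k − d ≥ 0`: the set of lattices `Λ(g)`,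
`↑g = T(k, y, d−k)` with `ϖ^{−d}`-unimodular Gram for `diag h`, has `ncard = Nat.card {ū ∈ 𝒪 ⧸ 𝔪^j : ū σ̄ū = r̄}` (`Λ ↦ u = ϖ^{k−d}y mod ϖ^j`, ★ `span_eq_span_iff_of_hermite`
+ §2), which ★ R2-A evaluates to `2q^{⌊j∕2⌋}` (`j ≥ 1`) ∕ `1` (`j = 0`): the `X′`-sphere of radius `2k − d` about the midpoint `Λ_C`.
[cite: LabesseLanglands1979, §2 p. 8] [cite: Jacobowitz1962, §7–§8] [cite: Serre1980Trees, Ch. II §1.1] -/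
theorem ncard_modular_hermite_diagonal_eq_natCard (hσϖ : σ ϖ = -ϖ) (σO : 𝒪[F] →+* 𝒪[F]) (hσO : ∀ x : 𝒪[F], ((σO x : 𝒪[F]) : F) = σ x)
    (hσσ : ∀ a, σO (σO a) = a) (r : 𝒪[F]) (hr : h 0 * (r : F) = -h 1) (d : ℤ) {k : ℤ} (hkd : 0 ≤ 2 * k - d) :
    {Λ : Submodule 𝒪[F] (Fin 2 → F) | ∃ (y : F) (g : GL (Fin 2) F), (g : Matrix (Fin 2) (Fin 2) F) = !![ϖ ^ k, y; 0, ϖ ^ (d - k)] ∧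
        IsUnimodular₂ (ϖ ^ (-d) • formCongr σ g (Matrix.diagonal h)) ∧ Λ = Submodule.span 𝒪[F] (Set.range ((g : Matrix (Fin 2) (Fin 2) F))ᵀ)}.ncard =
      Nat.card {x : 𝒪[F] ⧸ maximalIdeal 𝒪[F] ^ (2 * k - d).toNat //
        x * Ideal.quotientMap (maximalIdeal 𝒪[F] ^ (2 * k - d).toNat) σO
            (UnramifiedQuadraticNorm.maximalIdeal_pow_le_comap σO hσσ _) x = Ideal.Quotient.mk _ r} := by
  classical
  have h0 := hϖ.ne_zero
  have hσO' : ∀ x ∈ 𝒪[F], σ x ∈ 𝒪[F] := fun x hx => by rw [← hσO ⟨x, hx⟩]; exact SetLike.coe_mem _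
  set j : ℕ := (2 * k - d).toNat with hjdef
  have hj : (j : ℤ) = 2 * k - d := Int.toNat_of_nonneg hkd
  set I : Ideal 𝒪[F] := maximalIdeal 𝒪[F] ^ j with hI
  have hdetT : ∀ y : F, (!![ϖ ^ k, y; 0, ϖ ^ (d - k)] : Matrix (Fin 2) (Fin 2) F).det ≠ 0 := fun y => by
    rw [Matrix.det_fin_two_of, mul_zero, sub_zero]; exact mul_ne_zero (zpow_ne_zero _ h0) (zpow_ne_zero _ h0)
  have hlift : ∀ x : 𝒪[F] ⧸ I, ∃ u : 𝒪[F], Ideal.Quotient.mk I u = x := fun x => Ideal.Quotient.mk_surjective x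
  choose lift hlift using hlift
  have hzz : ϖ ^ (k - d) * ϖ ^ (-(k - d)) = 1 := by rw [← zpow_add₀ h0, add_neg_cancel, zpow_zero]
  -- the classification at exponent `k`, in the `u`-coordinate
  have hcls : ∀ (y : F) (g : GL (Fin 2) F), (g : Matrix (Fin 2) (Fin 2) F) = !![ϖ ^ k, y; 0, ϖ ^ (d - k)] →
      (IsUnimodular₂ (ϖ ^ (-d) • formCongr σ g (Matrix.diagonal h)) ↔
        ϖ ^ (k - d) * y ∈ 𝒪[F] ∧ ϖ ^ (-(2 * k - d)) * (h 0 * (ϖ ^ (k - d) * y * σ (ϖ ^ (k - d) * y)) + h 1) ∈ 𝒪[F]) := fun y g hg => by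
    rw [isUnimodular₂_zpow_smul_formCongr_hermite_diagonal_iff hϖ σ hh0 hh1 hσϖ hσO' d g hg]
    exact ⟨fun ⟨_, _, h3, h4⟩ => ⟨h3, h4⟩, fun ⟨h3, h4⟩ => ⟨rfl, hkd, h3, h4⟩⟩
  -- the norm congruence ↔ membership of the class in the fibre over `r̄`
  have hcong : ∀ u : 𝒪[F], ϖ ^ (-(2 * k - d)) * (h 0 * ((u : F) * σ u) + h 1) ∈ 𝒪[F] ↔
      Ideal.Quotient.mk I u * Ideal.quotientMap I σO (UnramifiedQuadraticNorm.maximalIdeal_pow_le_comap σO hσσ j) (Ideal.Quotient.mk I u) =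
        Ideal.Quotient.mk I r := fun u => by
    rw [← hj]; exact zpow_neg_mul_norm_congr_mem_iff hϖ σ hh0 σO hσO hσσ r hr j u
  change _ = Nat.card ({x : 𝒪[F] ⧸ I | x * Ideal.quotientMap I σO (UnramifiedQuadraticNorm.maximalIdeal_pow_le_comap σO hσσ j) x =
    Ideal.Quotient.mk I r} : Set (𝒪[F] ⧸ I))
  rw [Nat.card_coe_set_eq]
  symm
  refine Set.ncard_congr
    (fun x _ => Submodule.span 𝒪[F] (Set.range
      (!![ϖ ^ k, ϖ ^ (-(k - d)) * (lift x : F); 0, ϖ ^ (d - k)] : Matrix (Fin 2) (Fin 2) F)ᵀ)) ?_ ?_ ?_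
  · -- the lattice of a class is `ϖ^d`-modular Hermite of depth `k`
    intro x hx
    refine ⟨ϖ ^ (-(k - d)) * (lift x : F), Matrix.GeneralLinearGroup.mkOfDetNeZero _ (hdetT _),
      Matrix.GeneralLinearGroup.val_mkOfDetNeZero _ _, ?_, by rw [Matrix.GeneralLinearGroup.val_mkOfDetNeZero]⟩
    have hy : ϖ ^ (k - d) * (ϖ ^ (-(k - d)) * (lift x : F)) = lift x := by rw [← mul_assoc, hzz, one_mul]
    refine (hcls _ _ (Matrix.GeneralLinearGroup.val_mkOfDetNeZero _ _)).2 ⟨?_, ?_⟩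
    · rw [hy]; exact SetLike.coe_mem _
    · rw [hy]; exact (hcong (lift x)).2 (by rw [hlift]; exact hx)
  · -- injective: equal lattices have congruent `u`-coordinates
    intro x x' hx hx' hxx'
    have h3 := (span_eq_span_iff_of_hermite hϖ (Matrix.GeneralLinearGroup.mkOfDetNeZero _ (hdetT _))
      (Matrix.GeneralLinearGroup.mkOfDetNeZero _ (hdetT _)) (Matrix.GeneralLinearGroup.val_mkOfDetNeZero _ _)
      (Matrix.GeneralLinearGroup.val_mkOfDetNeZero _ _)).1 hxx'
    obtain ⟨-, -, h3⟩ := h3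
    have e3 : ϖ ^ (-k) * (ϖ ^ (-(k - d)) * (lift x' : F) - ϖ ^ (-(k - d)) * (lift x : F)) = ϖ ^ (-(j : ℤ)) * ((lift x' : F) - lift x) := by
      rw [← mul_sub, ← mul_assoc, ← zpow_add₀ h0, hj]; congr 2; ring
    rw [e3, zpow_neg_mul_coe_sub_mem_iff_mk_eq_mk hϖ j] at h3
    rw [← hlift x, ← hlift x', h3]
  · -- surjective: a `ϖ^d`-modular Hermite lattice of depth `k` comes from the class of its `u`-coordinate
    rintro Λ ⟨y, g, hg, hmod, rfl⟩
    obtain ⟨hu, hN⟩ := (hcls y g hg).1 hmod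
    refine ⟨Ideal.Quotient.mk I ⟨_, hu⟩, (hcong ⟨_, hu⟩).1 hN, ?_⟩
    refine span_eq_span_of_hermite_of_sub_mem hϖ (Matrix.GeneralLinearGroup.mkOfDetNeZero _ (hdetT _)) g
      (Matrix.GeneralLinearGroup.val_mkOfDetNeZero _ _) hg ?_
    have h4 : ϖ ^ (-(j : ℤ)) * (((lift (Ideal.Quotient.mk I ⟨_, hu⟩) : 𝒪[F]) : F) - ((⟨ϖ ^ (k - d) * y, hu⟩ : 𝒪[F]) : F)) ∈ 𝒪[F] :=
      (zpow_neg_mul_coe_sub_mem_iff_mk_eq_mk hϖ j _ _).2 (hlift _)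
    have e4 : ϖ ^ (-k) * (y - ϖ ^ (-(k - d)) * (lift (Ideal.Quotient.mk I ⟨_, hu⟩) : F)) =
        -(ϖ ^ (-(j : ℤ)) * (((lift (Ideal.Quotient.mk I ⟨_, hu⟩) : 𝒪[F]) : F) - ((⟨ϖ ^ (k - d) * y, hu⟩ : 𝒪[F]) : F))) := by
      rw [hj]
      have e5 : ϖ ^ (-(2 * k - d)) * ϖ ^ (k - d) = ϖ ^ (-k) := by rw [← zpow_add₀ h0]; congr 1; ring
      have e6 : ϖ ^ (-k) * ϖ ^ (-(k - d)) = ϖ ^ (-(2 * k - d)) := by rw [← zpow_add₀ h0]; congr 1; ring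
      push_cast
      linear_combination (-y) * e5 + (-(lift (Ideal.Quotient.mk I ⟨_, hu⟩) : F)) * e6
    rw [e4]
    exact Subring.neg_mem _ h4

end Count

end Literature.NumberTheory.Automorphic

end
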